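import Summits.CriticalPhenomena.SAWScalingLimit.Theorems.SAWDefectDecoherencePolygonParitySqueezeDefs
import Summits.CriticalPhenomena.SAWScalingLimit.Theorems.SAWDefectDecoherenceBoundaryClosureRPolygonLimitData
import HarnessLib

/-!
# Root integrability of the bulk weak limit (registered stub `rootIntegrable_of_limitData`;
# crux `BoundaryClosureR`, stmt-CriticalPhenomena-14004, line `polygon-parity-squeeze`)

A small glue lemma of the (A) assembly.  Let `D` be a Dobrushin domain, `(Λ, a, b)` a lattice family
with root and normaliser families, `ns' → 0⁺` a mesh sequence, `g` holomorphic on `Ω = D.carrier` and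
`η` a functional with

* (P_bulk) `N_{ns' n}(ψ) → η ψ` for every continuous compactly supported `ψ` with `pt 0 ∉ tsupport ψ`;
* (P_in) `η ψ = ∫ ψ g` whenever moreover `tsupport ψ ⊆ Ω`.

If the family is ROOT TIGHT at `pt 0` (`RootTightAt`), then `g` is integrable on `B(pt 0, r) ∩ Ω` for
some `r > 0`.

Proof.  Take `ε = 1` in `RootTightAt` and the resulting radius `r`.  For a continuous compactly
supported `ψ` with `tsupport ψ ⊆ B(pt 0, r) ∩ Ω` and `‖ψ‖ ≤ 1` (so `pt 0 ∉ tsupport ψ`, the carrier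
being open and `pt 0 ∈ ∂Ω`), `‖∫ ψ g‖ = ‖η ψ‖ = lim ‖N_{ns' n}(ψ)‖ ≤ 1`, because
`‖N_δ(ψ)‖ ≤ δ² Σ_{δ mid z ∈ B(pt 0, r)} ‖F(z)‖ / ‖F(b_δ)‖ ≤ 1` eventually
(`PolygonLimitData.norm_NF_le` and root tightness; if `F(b_δ) = 0` the functional vanishes).  The
duality lemma `PolygonLimitData.integrableOn_of_pairing_bound` ("`L¹` from bounded `C_c` pairings"
for a function continuous on an open set) then gives `IntegrableOn g (B(pt 0, r) ∩ Ω)`.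
-/

noncomputable section

open scoped BigOperators Topology Classical
open Filter Set Metric MeasureTheory
open Literature.Probability.LatticeModels Literature.Probability.RandomPlanarGeometry
open Literature.Probability.RandomPlanarGeometry.SAW
open Summit.CriticalPhenomena.SAWScalingLimit.Theses.SAWDefectDecoherence
open Summit.CriticalPhenomena.SAWScalingLimit.Theorems.PolygonParitySqueeze.PolygonLimitData

namespace Summit.CriticalPhenomena.SAWScalingLimit.Theorems.PolygonParitySqueeze

/-- **Registered stub `rootIntegrable_of_limitData`** (glue lemma of the (A) assembly of
`stub_polygonIdentification`, crux item stmt-CriticalPhenomena-14004, line `polygon-parity-squeeze`):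
under root tightness, the bulk weak limit `g` of the normalised functionals (represented by `η` off the
root and by `∫ · g` inside the carrier) is integrable on `B(pt 0, r) ∩ Ω` for some `r > 0`.  See the
module docstring for the proof. [cite: DuminilCopinSmirnov2012, Conjecture 2 (normalised observable)] -/
theorem rootIntegrable_of_limitData : ∀ (D : DobrushinDomain) (Λ : ℝ → Finset HexVertex) (a b : ℝ → Sym2 HexVertex) (ns' : ℕ → ℝ) (g : ℂ → ℂ) (η : (ℂ → ℂ) → ℂ), Filter.Tendsto ns' Filter.atTop (𝓝[>] 0) → RootTightAt Λ a b (D.pt 0) → DifferentiableOn ℂ g D.carrier → (∀ ψ : ℂ → ℂ, Continuous ψ → HasCompactSupport ψ → D.pt 0 ∉ tsupport ψ → Filter.Tendsto (fun n => NF Λ a b (ns' n) ψ) Filter.atTop (𝓝 (η ψ))) → (∀ ψ : ℂ → ℂ, Continuous ψ → HasCompactSupport ψ → tsupport ψ ⊆ D.carrier → η ψ = ∫ z, ψ z * g z) → ∃ r : ℝ, 0 < r ∧ MeasureTheory.IntegrableOn g (Metric.ball (D.pt 0) r ∩ D.carrier) := by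
  intro D Λ a b ns' g η hns' hRT hg hPbulk hPin
  -- the root is not a point of the (open) carrier
  have hpt0D : D.pt 0 ∉ D.carrier := fun h => by
    have h' : D.pt 0 ∈ D.carrier ∩ frontier D.carrier := ⟨h, D.pt_mem_frontier 0⟩
    rw [D.isOpen.inter_frontier_eq] at h'
    exact h'
  -- root tightness with `ε = 1`
  obtain ⟨r, hr, hev⟩ := hRT 1 one_pos
  refine ⟨r, hr, ?_⟩
  have hV : IsOpen (ball (D.pt 0) r ∩ D.carrier) := isOpen_ball.inter D.isOpen
  have hgV : ContinuousOn g (ball (D.pt 0) r ∩ D.carrier) := hg.continuousOn.mono inter_subset_right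
  refine (integrableOn_of_pairing_bound hV hgV (C := 1) fun ψ hψ hψc hψV hψ1 => ?_).1
  -- the pairing is the limit of the normalised functionals
  have hψD : tsupport ψ ⊆ D.carrier := hψV.trans inter_subset_right
  have hψ0 : D.pt 0 ∉ tsupport ψ := fun h => hpt0D (hψD h)
  have hlim : Tendsto (fun n => ‖NF Λ a b (ns' n) ψ‖) atTop (𝓝 ‖∫ z, ψ z * g z‖) := by
    rw [← hPin ψ hψ hψc hψD]
    exact (hPbulk ψ hψ hψc hψ0).norm
  have hS : ∀ z, ψ z ≠ 0 → z ∈ ball (D.pt 0) r := fun z hz => (hψV (subset_tsupport _ hz)).1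
  refine le_of_tendsto hlim ?_
  filter_upwards [hns'.eventually hev] with n hn
  refine (norm_NF_le (Λ (ns' n))
    (hexParafermionicObservable (Λ (ns' n)) (a (ns' n)) hexCriticalFugacity (5 / 8))
    (hexParafermionicObservable (Λ (ns' n)) (a (ns' n)) hexCriticalFugacity (5 / 8) (b (ns' n)))
    (ns' n) hψ1 hS).trans ?_
  rw [one_mul]
  by_cases hFb : ‖hexParafermionicObservable (Λ (ns' n)) (a (ns' n)) hexCriticalFugacity (5 / 8)
      (b (ns' n))‖ = 0
  · rw [hFb, div_zero]; exact zero_le_one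
  · rw [div_le_iff₀ (lt_of_le_of_ne (norm_nonneg _) (Ne.symm hFb))]
    exact hn

end Summit.CriticalPhenomena.SAWScalingLimit.Theorems.PolygonParitySqueeze

end
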